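import Summits.HodgeConjecture.HodgeConjecture.Theorems.LinearSystemTorelliLocalTubeSpanMultiTail
import Summits.HodgeConjecture.HodgeConjecture.Theorems.LinearSystemTorelliLocalTubeSpanFramePartialSpan

/-!
# Route LinearSystemTorelli — crux `LocalTubeSpan`: multi-branch points (orthogonal clusters + nodes)

Helper file (`--supports stmt-HodgeConjecture-2490`, line `Sketch`, stub `stub_multiCluster` — the
general multi-orbit configuration statement `P(V; δ)` of the crux idea card
pencil-configuration-janssen for GEOMETRIC configurations: every branch of the local discriminant is
either Janssen-complete or nodal, and distinct branches have orthogonal vanishing cycles).  The local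
monodromy group `G` at such a point is generated by the meridians `s j` (`j : Fin b`) of the clusters
and the node meridians `s₀`, acting on `V = H^{2p-1}(X_s, ℚ)_van` by Picard–Lefschetz transvections
`t(x) = x - B(x, e_t) e_t` of the nondegenerate alternating intersection form.

* `localTubeSpan_injective_evalCoinv_of_multiCluster` — Schnell's third map
  `H¹(G, V) → ∏_{g ∈ G} V/(g - 1)V` is injective, given, for each cluster, a linearly independent
  transvection frame inside `⟨s j⟩` in which every meridian of the cluster has a positive power up to
  elements acting trivially on `L_j = ℚe(s j)` (Schnell2010 Lemma 11 / Janssen Thm. 2.5 for the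
  complete orbit), no cluster cycle in the radical of its `L_j`, and Janssen companions `a, a + cℓ` in
  `⟨s j⟩` for every non-zero radical vector `ℓ` of `L_j` (Janssen Thm. 2.9).

Proof: cluster by cluster the partial frame theorem (`…FramePartialSpan`; the other generators' cycles
are orthogonal to `L_j`) produces `v_j` with `φ = dv_j` on `s j`; the multi-tail (`…MultiTail`) glues.
The one-cluster cases are `…Mixed` (with nodes) and `…Radical` (no nodes, via Lemma 11 directly).
Reference: C. Schnell, Math. Z. 268 (2010) §7; W. Janssen, Math. Ann. 266 (1983) Thms. 2.5, 2.9.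
No named facts (both Janssen inputs are hypotheses, to be discharged from
`Literature.AlgebraicGeometry.HodgeTheory.SkewVanishingLattice`).
-/

-- `Summit.HodgeConjecture.HodgeConjecture.Theorems` is the mandated namespace (single-conjunct summit:
-- Sub = Summit), which `linter.dupNamespace` flags on every declaration; the lakefile turns the
-- linter off tree-wide (weak option), restated here so stand-alone elaboration is warning-free too.
set_option linter.dupNamespace false

noncomputable section

open CategoryTheory groupCohomology
open Literature.AlgebraicGeometry.HodgeTheory

namespace Summit.HodgeConjecture.HodgeConjecture.Theorems

section MultiCluster

variable {G : Type} [Group G] (A : Rep.{0} ℚ G)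

/-- **The local Schnell theorem at a multi-branch point** (orthogonal Janssen clusters + transversal
nodes; hypotheses in the module docstring): Schnell's third map `H¹(G, V) → ∏_{g ∈ G} V/(g - 1)V`
is injective. [cite: Schnell2010, §7 Prop. 12 (proof)] -/
theorem localTubeSpan_injective_evalCoinv_of_multiCluster [FiniteDimensional ℚ A.V]
    (B : LinearMap.BilinForm ℚ A.V) (hB : B.Nondegenerate) (hBalt : B.IsAlt)
    {b : ℕ} (s : Fin b → Set G) (s₀ : Set G) (hs : Subgroup.closure (s₀ ∪ ⋃ j, s j) = ⊤)
    (e : G → A.V) (hPL : ∀ t ∈ s₀ ∪ ⋃ j, s j, ∀ x : A.V, A.ρ t x = x - B x (e t) • e t)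
    (horth : ∀ i j, i ≠ j → ∀ t ∈ s i, ∀ t' ∈ s j, B (e t) (e t') = 0)
    (horth₀ : ∀ t ∈ s₀, ∀ t' ∈ s₀ ∪ ⋃ j, s j, B (e t) (e t') = 0) (hne₀ : ∀ t ∈ s₀, e t ≠ 0)
    (hnotR : ∀ (j : Fin b), ∀ t ∈ s j,
      e t ∉ Submodule.span ℚ (e '' s j) ⊓ B.orthogonal (Submodule.span ℚ (e '' s j)))
    (r : Fin b → ℕ) (u : (j : Fin b) → Fin (r j) → G) (hu₁ : ∀ j i, u j i ∈ Subgroup.closure (s j))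
    (δ' : (j : Fin b) → Fin (r j) → A.V) (hli : ∀ j, LinearIndependent ℚ (δ' j))
    (hu : ∀ (j : Fin b) (i : Fin (r j)) (x : A.V), A.ρ (u j i) x = x - B x (δ' j i) • δ' j i)
    (hvirtL : ∀ (j : Fin b), ∀ t ∈ s j, ∃ m : ℕ, 0 < m ∧ ∃ γ ∈ Subgroup.closure (Set.range (u j)),
      ∀ x ∈ Submodule.span ℚ (e '' s j), A.ρ (t ^ m) x = A.ρ γ x)
    (hcomp : ∀ (j : Fin b), ∀ ℓ ∈ Submodule.span ℚ (e '' s j) ⊓ B.orthogonal (Submodule.span ℚ (e '' s j)),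
      ℓ ≠ 0 → ∃ g₁ ∈ Subgroup.closure (s j), ∃ g₂ ∈ Subgroup.closure (s j), ∃ (a : A.V) (c : ℚ),
        a ≠ 0 ∧ a + c • ℓ ≠ 0 ∧ c ≠ 0 ∧ a ∈ Submodule.span ℚ (e '' s j) ∧
        (∀ x : A.V, A.ρ g₁ x = x - B x a • a) ∧
        (∀ x : A.V, A.ρ g₂ x = x - B x (a + c • ℓ) • (a + c • ℓ))) :
    Function.Injective (evalCoinv A) := by
  refine (injective_iff_map_eq_zero _).2 fun ξ hξ => ?_
  induction ξ using H1_induction_on with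
  | h φ =>
    have hund : ∀ g : G, (φ : G → A.V) g ∈ subOneRange A g := fun g => by
      have := congr_fun hξ g
      rwa [evalCoinv_H1π, Pi.zero_apply, Submodule.mkQ_apply, Submodule.Quotient.mk_eq_zero]
        at this
    have hanti : ∀ x y : A.V, B x y = -B y x := fun x y => (hBalt.neg_eq y x).symm
    -- the other generators' cycles are orthogonal to each cluster lattice
    have hout : ∀ (j : Fin b), ∀ t ∈ (s₀ ∪ ⋃ i, s i) \ s j,
        ∀ y ∈ Submodule.span ℚ (e '' s j), B y (e t) = 0 := by
      intro j t ht y hy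
      have hgen : ∀ y' ∈ e '' s j, B y' (e t) = 0 := by
        rintro _ ⟨t', ht', rfl⟩
        rcases ht.1 with ht₀ | hti
        · rw [hanti, horth₀ t ht₀ t' (Or.inr (Set.mem_iUnion.2 ⟨j, ht'⟩)), neg_zero]
        · obtain ⟨i, hti⟩ := Set.mem_iUnion.1 hti
          have hij : i ≠ j := by rintro rfl; exact ht.2 hti
          exact horth j i (Ne.symm hij) t' ht' t hti
      refine Submodule.span_induction hgen (by simp) (fun x z _ _ hx hz => ?_)
        (fun q x _ hx => ?_) hy
      · rw [map_add, LinearMap.add_apply, hx, hz, add_zero]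
      · rw [map_smul, LinearMap.smul_apply, hx, smul_zero]
    -- cluster by cluster: `φ = dv_j` on `s j`
    have hvj : ∀ j : Fin b, ∃ v : A.V, ∀ t ∈ s j, (φ : G → A.V) t = A.ρ t v - v := fun j =>
      localTubeSpan_exists_sub_eq_of_frame_on_span_partial A B hBalt (s₀ ∪ ⋃ i, s i) hs e hPL (s j)
        (fun t ht => Or.inr (Set.mem_iUnion.2 ⟨j, ht⟩)) (hnotR j) (hout j) (u j) (hu₁ j) (δ' j)
        (hli j) (hu j) (hvirtL j) φ hund
    choose v hv using hvj
    exact localTubeSpan_H1π_eq_zero_of_multiTail A B s s₀ e hB hBalt hs hPL horth horth₀ hne₀ hcomp φ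
      hund v hv

end MultiCluster

end Summit.HodgeConjecture.HodgeConjecture.Theorems

end
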